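import Summits.Ventures.PercRepro.AntipodalSMC

/-!
# Lemma B for the flat lattices `M n`: the number of crossing cells does not matter

`Mn n` is the lattice `⊥ < m 0, …, m (n-1) < ⊤` with the `n` middle elements pairwise incomparable
(`M₃` is `Part(3)`; for `n = s` it is the target of the finest colouring of a sub-cube's middle by its
`s` comparability components, `HOME/proofs/P4-components.md` §4). The Lemma B kernel on `Mn n` —
`+1` on `(⊥, ⊤)` and `(⊤, ⊥)`, `−1` on `(m i, m j)` with `i ≠ j`, `0` elsewhere — has nonpositive
second differences on EVERY comparable quadruple, for every `n` (nine non-degenerate cases, none of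
which depends on `n`; `kernel_second_difference_nonpos`). Hence p6's antipodal SMC principle
(`sum_kernel_compl_nonneg`) gives **Lemma B for every monotone map into `Mn n`**
(`lemmaB_Mn`): the antipodal pairs carrying two distinct middle elements are at most the antipodal
pairs of type `{⊥, ⊤}` (`crossing_card_le_good_card`). In particular, for any monotone map of a
cube into a lattice whose middle (the cells other than `⊥`, `⊤`) is an antichain, the `(⊥, ⊤)`
antipodal pairs dominate ALL antipodal pairs of the middle lying in different comparability
components of the middle — the colour-free form `L∞` of Lemma B.
-/

namespace PercRepro

open Finset

/-- The flat lattice `⊥ < m i < ⊤` with `n` pairwise incomparable middle elements. -/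
inductive Mn (n : ℕ)
  | bot : Mn n
  | mid : Fin n → Mn n
  | top : Mn n
  deriving DecidableEq

namespace Mn

variable {n : ℕ}

/-- The order: `⊥` below everything, `⊤` above everything, middle elements only below themselves. -/
def le : Mn n → Mn n → Prop
  | bot, _ => True
  | _, top => True
  | mid i, mid j => i = j
  | top, bot => False
  | top, mid _ => False
  | mid _, bot => False

/-- `≤` on `Mn n` is the relation `le`. -/
instance : LE (Mn n) := ⟨le⟩

/-- The order on `Mn n` unfolds to the relation `le`. -/
theorem le_def (a b : Mn n) : a ≤ b ↔ le a b := Iff.rfl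

/-- `⊥` is below every element of `Mn n`. -/
@[simp] theorem bot_le' (a : Mn n) : (bot : Mn n) ≤ a := by cases a <;> trivial
/-- `⊤` is above every element of `Mn n`. -/
@[simp] theorem le_top' (a : Mn n) : a ≤ (top : Mn n) := by cases a <;> trivial
/-- Two middle elements are comparable only when they are equal. -/
@[simp] theorem mid_le_mid_iff {i j : Fin n} : (mid i : Mn n) ≤ mid j ↔ i = j := Iff.rfl
/-- `⊤ ≤ ⊥` fails. -/
@[simp] theorem not_top_le_bot : ¬ ((top : Mn n) ≤ bot) := fun h => h
/-- `⊤ ≤ m i` fails. -/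
@[simp] theorem not_top_le_mid (i : Fin n) : ¬ ((top : Mn n) ≤ mid i) := fun h => h
/-- `m i ≤ ⊥` fails. -/
@[simp] theorem not_mid_le_bot (i : Fin n) : ¬ ((mid i : Mn n) ≤ bot) := fun h => h

/-- `Mn n` is a preorder: `le` is reflexive and transitive (case check). -/
instance : Preorder (Mn n) where
  le := le
  le_refl a := by cases a <;> trivial
  le_trans a b c hab hbc := by
    cases a <;> cases b <;> cases c <;> simp_all [le]

/-- `Mn n` is a partial order: `le` is antisymmetric (case check). -/
instance : PartialOrder (Mn n) where
  le_antisymm a b hab hba := by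
    cases a <;> cases b <;> simp_all [le_def, le]

/-- The Lemma B kernel on `Mn n`: `+1` on `(⊥, ⊤)`, `(⊤, ⊥)`; `−1` on `(m i, m j)`, `i ≠ j`; `0` else. -/
def kernel : Mn n → Mn n → ℝ
  | bot, top => 1
  | top, bot => 1
  | mid i, mid j => if i = j then 0 else -1
  | _, _ => 0

/-- `kernel ⊥ ⊤ = 1`. -/
@[simp] theorem kernel_bot_top : kernel (bot : Mn n) top = 1 := rfl
/-- `kernel ⊤ ⊥ = 1`. -/
@[simp] theorem kernel_top_bot : kernel (top : Mn n) bot = 1 := rfl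
/-- `kernel (m i) (m j)` is `0` for `i = j` and `−1` otherwise. -/
@[simp] theorem kernel_mid_mid (i j : Fin n) :
    kernel (mid i : Mn n) (mid j) = if i = j then 0 else -1 := rfl
/-- `kernel ⊥ ⊥ = 0`. -/
@[simp] theorem kernel_bot_bot : kernel (bot : Mn n) bot = 0 := rfl
/-- `kernel ⊤ ⊤ = 0`. -/
@[simp] theorem kernel_top_top : kernel (top : Mn n) top = 0 := rfl
/-- `kernel ⊥ (m j) = 0`. -/
@[simp] theorem kernel_bot_mid (j : Fin n) : kernel (bot : Mn n) (mid j) = 0 := rfl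
/-- `kernel (m i) ⊥ = 0`. -/
@[simp] theorem kernel_mid_bot (i : Fin n) : kernel (mid i : Mn n) bot = 0 := rfl
/-- `kernel ⊤ (m j) = 0`. -/
@[simp] theorem kernel_top_mid (j : Fin n) : kernel (top : Mn n) (mid j) = 0 := rfl
/-- `kernel (m i) ⊤ = 0`. -/
@[simp] theorem kernel_mid_top (i : Fin n) : kernel (mid i : Mn n) top = 0 := rfl

/-- The kernel has nonnegative diagonal. -/
theorem kernel_diag_nonneg (a : Mn n) : 0 ≤ kernel a a := by
  cases a <;> simp

/-- **The second differences of the kernel are nonpositive on every comparable quadruple**, for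
every `n`: `A b b' − A b a' − A a b' + A a a' ≤ 0` whenever `a ≤ b` and `a' ≤ b'`. -/
theorem kernel_second_difference_nonpos (a b a' b' : Mn n) (hab : a ≤ b) (hab' : a' ≤ b') :
    kernel b b' - kernel b a' - kernel a b' + kernel a a' ≤ 0 := by
  cases a <;> cases b <;> cases a' <;> cases b' <;> simp_all [le_def, le] <;> split_ifs <;> simp_all

end Mn

variable {E : Type*} [Fintype E] [DecidableEq E]

/-- **Lemma B on `Mn n` (kernel form)**: for every monotone `c : Config E → Mn n`,
`Σ_σ kernel (c σ) (c σᶜ) ≥ 0`. -/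
theorem lemmaB_Mn {n : ℕ} (c : Config E → Mn n) (hc : Monotone c) :
    0 ≤ ∑ σ : Config E, Mn.kernel (c σ) (c σᶜ) :=
  sum_kernel_compl_nonneg hc Mn.kernel Mn.kernel_diag_nonneg
    (fun a b a' b' hab hab' => Mn.kernel_second_difference_nonpos a b a' b' hab hab')

open scoped Classical in
/-- **Lemma B on `Mn n` (counting form)**: the ordered antipodal pairs carrying two distinct middle
elements are at most the ordered antipodal pairs of type `{⊥, ⊤}` (each unordered pair counted twice
on both sides). -/
theorem crossing_card_le_good_card {n : ℕ} (c : Config E → Mn n) (hc : Monotone c) :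
    (univ.filter fun σ : Config E => ∃ i j : Fin n, i ≠ j ∧ c σ = Mn.mid i ∧ c σᶜ = Mn.mid j).card ≤
      (univ.filter fun σ : Config E => c σ = Mn.bot ∧ c σᶜ = Mn.top).card +
        (univ.filter fun σ : Config E => c σ = Mn.top ∧ c σᶜ = Mn.bot).card := by
  have h := lemmaB_Mn c hc
  -- the kernel is the difference of the indicators
  have hk : ∀ σ : Config E, Mn.kernel (c σ) (c σᶜ) =
      ((if c σ = Mn.bot ∧ c σᶜ = Mn.top then (1 : ℝ) else 0) +
        (if c σ = Mn.top ∧ c σᶜ = Mn.bot then (1 : ℝ) else 0)) -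
        (if ∃ i j : Fin n, i ≠ j ∧ c σ = Mn.mid i ∧ c σᶜ = Mn.mid j then (1 : ℝ) else 0) := by
    intro σ
    rcases ha : c σ with _ | i | _ <;> rcases hb : c σᶜ with _ | j | _ <;> simp
    · by_cases hij : i = j
      · subst hij; simp
      · simp [hij]
  simp only [hk, Finset.sum_sub_distrib, Finset.sum_add_distrib] at h
  -- real-valued indicator sums are cardinalities
  have e1 : ∀ (p : Config E → Prop) [DecidablePred p],
      (∑ σ : Config E, (if p σ then (1 : ℝ) else 0)) = ((univ.filter p).card : ℝ) := by
    intro p _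
    rw [Finset.card_filter, Nat.cast_sum]
    refine Finset.sum_congr rfl ?_
    intro σ _
    split_ifs <;> simp
  simp only [e1] at h
  have h' : ((univ.filter fun σ : Config E =>
      ∃ i j : Fin n, i ≠ j ∧ c σ = Mn.mid i ∧ c σᶜ = Mn.mid j).card : ℝ) ≤
      ((univ.filter fun σ : Config E => c σ = Mn.bot ∧ c σᶜ = Mn.top).card : ℝ) +
        ((univ.filter fun σ : Config E => c σ = Mn.top ∧ c σᶜ = Mn.bot).card : ℝ) := by
    linarith
  exact_mod_cast h'

end PercRepro
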